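import Mathlib
import Summits.ValiantsHypothesis.ValiantsHypothesis.Theorems.GrenetZeonTwoDimCoefficientsScalingThreeHalvesConditional
import Summits.ValiantsHypothesis.ValiantsHypothesis.Theorems.GrenetZeonTwoDimCoefficientsScalingCodimLtPerGenericity

/-!
# Crux `GrenetZeon.TwoDimCoefficients` (stmt-ValiantsHypothesis-8062) / rung `DualUnipotentThreeHalves` (stmt-24318):
# scaling-closure — T4 WITHOUT A PER-GENERICITY CLAUSE for index reductions of corank `< n` (conditional assembly, sharp range)

The eighteenth hand closed the decl `DualUnipotentThreeHalves` modulo T4 (✓ p836227): an index-reducing substitution `T` of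
corank `κ` TOGETHER WITH a point `T w` of Hessian rank `≥ n² − κ′`, `2(κ′ + 2κ) ≤ n²`.  By the SHARP ✓ PG(k < n)
(`exists_mem_fullRank_hess0_perPoly_of_codim_lt`, this hand; sibling of the `≤ n/2` file `…ThreeHalvesSmallCorank`) the image of ANY
`T` of corank `< n` contains a FULL-RANK point of `Hess per_n`, so for such substitutions the per-genericity clause disappears:

  IC(<n): every unipotent dual representation of `per_n` (`n ≥ 3`) in pencil form `A = A₀(1 − N)` with `Nⁿ ≠ 0` admits a linear
  substitution `T` with `(N ∘ T)ⁿ = 0` and `n² ≤ rank T + κ`, `κ < n`.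

* ★★ `threeHalves_of_corankLtIndexReduction` — IC(<n) ⟹ `∀ n ≥ 3, DualUnipotentRepr n m → n³ ≤ 4m²`;
* ★★ `dualUnipotentThreeHalves_of_corankLtIndexReduction` — IC(<n) ⟹ `Theses.GrenetZeon.DualUnipotentThreeHalves` BY NAME.

HONEST FRAMING: CONDITIONAL on IC(<n) — a pure INDEX-COST statement, OPEN; corank `≈ dim(N-space)/n ≤ n` is exactly the heuristic
cost of index reduction for band-type garbage (memo NINETEENTH-HAND.md §8), so this sharp range is the natural frontier; beyond it
(corank `≥ n`) König-type sections exist and per-genericity must be argued per section.  Item 24318 is NOT closed;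
the stub `DualUnipotentBound`, crux 8062 and `VP ≠ VNP` remain open.

References: T. Mignon, N. Ressayre, Int. Math. Res. Not. 2004:79, Thm. 1.1 (via the tree); folklore.
-/

-- single-conjunct layout `Summits/ValiantsHypothesis/ValiantsHypothesis`: the duplicated namespace
-- component is mandated by the tree.
set_option linter.dupNamespace false
set_option autoImplicit false

noncomputable section

namespace Summit.ValiantsHypothesis.ValiantsHypothesis.Theorems.GrenetZeonTwoDimCoefficients.ScalingClosure

open MvPolynomial Matrix
open Literature.Computability.AlgebraicComplexity
open Literature.Algebra.Polynomial
open Summit.ValiantsHypothesis.ValiantsHypothesis.Cruxes.TwoDimCoefficients.DimTwoCases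

section CorankLt

/-- ★★ **IC(<n) ⟹ `n³ ≤ 4m²` for every unipotent dual representation (`n ≥ 3`).**  HYPOTHESIS `hIC` (open, pure index-cost —
see the module docstring): index reduction by a substitution of corank `< n`.  Per-genericity is supplied by the sharp ✓ PG(k < n) and
the rest by ✓ `threeHalves_of_perGenericIndexReduction` (`4κ ≤ n²` holds for `κ < n`, `n ≥ 3`). [cite: MignonRessayre2004, Thm. 1.1 — via the tree; folklore] -/
theorem threeHalves_of_corankLtIndexReduction
    (hIC : ∀ (n m : ℕ) (A B : AffMat n m) (A₀ P₀ : Matrix (Fin m) (Fin m) ℂ) (N : AffMat n m) (α β c : ℂ),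
      3 ≤ n → IsAffine A → IsAffine B → c ≠ 0 → β ≠ 0 → A.det = MvPolynomial.C c →
      perPoly (Fin n) ℂ = MvPolynomial.C α * A.det + MvPolynomial.C β * (A.adjugate * B).trace →
      A₀ * P₀ = 1 → (∀ i j, (N i j).IsHomogeneous 1) → A = A₀.map MvPolynomial.C * (1 - N) → N ^ n ≠ 0 →
      ∃ (T : Matrix (Fin n × Fin n) (Fin n × Fin n) ℂ) (κ : ℕ),
        (N.map (bind₁ (linSubst T))) ^ n = 0 ∧ n ^ 2 ≤ T.rank + κ ∧ κ < n) :
    ∀ n : ℕ, 3 ≤ n → ∀ m : ℕ, DualUnipotentRepr n m → n ^ 3 ≤ 4 * m ^ 2 := by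
  classical
  refine threeHalves_of_perGenericIndexReduction ?_
  intro n m A B A₀ P₀ N α β c hn hA hB hc hβ hdet hper hP₀ hN hAN hNn
  obtain ⟨T, κ, hTn, hκ, hκn⟩ := hIC n m A B A₀ P₀ N α β c hn hA hB hc hβ hdet hper hP₀ hN hAN hNn
  -- a full-rank point in the image of `T` (sharp PG(k < n))
  have hV : n ^ 2 ≤ Module.finrank ℂ (LinearMap.range T.mulVecLin) + κ := hκ
  obtain ⟨z, hz, hrank⟩ :=
    exists_mem_fullRank_hess0_perPoly_of_codim_lt (by omega) (LinearMap.range T.mulVecLin) κ hV hκn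
  obtain ⟨w, hw⟩ := LinearMap.mem_range.mp hz
  refine ⟨T, w, κ, 0, hTn, hκ, ?_, by nlinarith⟩
  rw [← Matrix.mulVecLin_apply, hw, hrank, add_zero]

/-- ★★ **IC(<n) ⟹ the route decl `DualUnipotentThreeHalves` (stmt-24318) BY NAME**, with `C = 4`, `n₀ = 3`.  CONDITIONAL on the
pure index-cost hypothesis IC(<n) (open). [cite: MignonRessayre2004, Thm. 1.1 — via the tree; folklore] -/
theorem dualUnipotentThreeHalves_of_corankLtIndexReduction
    (hIC : ∀ (n m : ℕ) (A B : AffMat n m) (A₀ P₀ : Matrix (Fin m) (Fin m) ℂ) (N : AffMat n m) (α β c : ℂ),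
      3 ≤ n → IsAffine A → IsAffine B → c ≠ 0 → β ≠ 0 → A.det = MvPolynomial.C c →
      perPoly (Fin n) ℂ = MvPolynomial.C α * A.det + MvPolynomial.C β * (A.adjugate * B).trace →
      A₀ * P₀ = 1 → (∀ i j, (N i j).IsHomogeneous 1) → A = A₀.map MvPolynomial.C * (1 - N) → N ^ n ≠ 0 →
      ∃ (T : Matrix (Fin n × Fin n) (Fin n × Fin n) ℂ) (κ : ℕ),
        (N.map (bind₁ (linSubst T))) ^ n = 0 ∧ n ^ 2 ≤ T.rank + κ ∧ κ < n) :
    Summit.ValiantsHypothesis.ValiantsHypothesis.Theses.GrenetZeon.DualUnipotentThreeHalves := by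
  unfold Summit.ValiantsHypothesis.ValiantsHypothesis.Theses.GrenetZeon.DualUnipotentThreeHalves
  refine ⟨4, 3, fun n hn m hrep => ?_⟩
  exact threeHalves_of_corankLtIndexReduction hIC n hn m hrep

end CorankLt

end Summit.ValiantsHypothesis.ValiantsHypothesis.Theorems.GrenetZeonTwoDimCoefficients.ScalingClosure

end
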